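import Summits.HodgeConjecture.HodgeConjecture.Theorems.PadicSemiregularLiftHodgeFermatVarietiesLatticeCriterion
import Summits.HodgeConjecture.HodgeConjecture.Theorems.PadicSemiregularLiftHodgeFermatVarietiesPrintedSupply
import Summits.HodgeConjecture.HodgeConjecture.Theorems.PadicSemiregularLiftHodgeFermatVarietiesSaturation66Graph
import HarnessLib

/-!
# D66: every Hodge multiset of `ℤ/66` is reachable at its own level — HC for the Fermat varieties of degree 66 modulo the stubs

Crux `HodgeFermatVarieties` (stmt-HodgeConjecture-1334), line `cancel-by-any-claim-lattice`; the degree-`66`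
companion of `…Saturation33` / `…Saturation39` / `…Saturation99` (lead c1). Degree `66` is SATURATED AT ITS OWN
LEVEL (census: `[K_66 : L_D(66)] = 1`, `k = 1`) and is covered by no theorem in print (not `m ≤ 21`, `27`; not
`pᵉ`, `2pᵉ`; not `2ᵃ3ᵇ5ᶜ7ᵈ` with `cd = 0`). PROVED:

    reach_sixtySix       : IsHodgeMultiset s → Reach[66, s]
    stableReach_sixtySix : IsHodgeMultiset s → StableReach[66, s]
    hodgeConjectureFor_sixtySix : HC for every smooth projective Fermat variety of degree 66,
      granted the six S0 named facts and the statements of the stubs S2↑, S2↓, S3a, S5.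

Certificate (`calc/satcert.py 66`; kernel-checked): with the graph identity of `…Saturation66Graph`, each basis vector
`v_a = A a − B a` (`a ∈ F`, `a ≠ 33`) — corrected by `E a = {33}` when `|A a| + |B a|` is odd, since at the EVEN
level `66` the Hodge lattice `K` (even total multiplicity, `IsHodgeMultiset.even_card`) has index `2` in `L ∋ e_33` —
has a reach certificate `A a + E a + Σ(N a) = B a + Σ(P a)`, and the `33`-coordinate is balanced by the pair `{33, 33}`
on both sides (`even_count_a0`); the certificates use supply
elements of level `66`: 22 pairs, 32 Hodge 4-multisets, 1 semi-decomposable Hodge sextuples, 0 standard elements.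

References: [Shioda1979PJA] Proc. Japan Acad. 55A (1979) §1–2; [Aoki1987] J. Math. Soc. Japan 39 (1987) Thm 1-4, 2-1;
[AokiShioda1983] Generators of the Néron–Severi group of a Fermat surface, §2 (2.1); [Ran1980] Compositio Math. 42, Prop. 1.7.
-/

set_option linter.dupNamespace false

noncomputable section

open Finset
open Literature.AlgebraicGeometry.HodgeTheory Literature.AlgebraicGeometry.HodgeTheory.FermatCharacter

namespace Summit.HodgeConjecture.HodgeConjecture.Theorems.CancelByAnyClaimLattice.D66

/-- `Supply[M]` — the printed supply of level `M` (local notation of the line, verbatim). -/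
local notation3 (prettyPrint := false) "Supply[" M "]" =>
  ({s : Multiset (ZMod M) | ∃ a : ZMod M, a ≠ 0 ∧ s = ({a, -a} : Multiset (ZMod M))} ∪
    {s : Multiset (ZMod M) | IsHodgeMultiset s ∧ Multiset.card s = 4} ∪
    {s : Multiset (ZMod M) | IsHodgeMultiset s ∧ IsSemiDecomposable s} ∪
    {s : Multiset (ZMod M) | ∃ (p : ℕ) (a : ZMod M), p.Prime ∧ p ≠ 2 ∧ p ∣ M ∧
        2 < (M / p) / Nat.gcd (ZMod.val a) (M / p) ∧
        s = Multiset.map (fun j : ℕ => a + (j : ZMod M) * ((M / p : ℕ) : ZMod M)) (Multiset.range p) +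
              {-((p : ZMod M) * a)}} : Set (Multiset (ZMod M)))

/-- `Reach[M, s]` (local notation of the line, verbatim). -/
local notation3 (prettyPrint := false) "Reach[" M ", " s "]" =>
  ∃ P N : Multiset (Multiset (ZMod M)),
    (∀ u ∈ P, u ∈ Supply[M]) ∧ (∀ u ∈ N, u ∈ Supply[M]) ∧ s + Multiset.sum N = Multiset.sum P

/-- `LevelRaise[k, m, s]` (local notation of the line, verbatim). -/
local notation3 (prettyPrint := false) "LevelRaise[" k ", " m ", " s "]" =>
  Multiset.map (fun a : ZMod m => ((k * ZMod.val a : ℕ) : ZMod (k * m))) s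

/-- `StableReach[m, s]` (local notation of the line, verbatim). -/
local notation3 (prettyPrint := false) "StableReach[" m ", " s "]" => ∃ k : ℕ, 0 < k ∧ Reach[k * m, LevelRaise[k, m, s]]

/-! ### The certificates -/

/-- `P66 a` — positive supply part of the level-66 reach certificate of `v_a` (`a ∈ F`, `a ≠ 33`). [folklore] -/
def P66 (a : ZMod 66) : Multiset (Multiset (ZMod 66)) :=
  if a = 1 then {({10, 56} : Multiset (ZMod 66))} + {({1, 33, 34, 64} : Multiset (ZMod 66))} else
  if a = 3 then {({3, 63} : Multiset (ZMod 66))} + {({33, 33} : Multiset (ZMod 66))} else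
  if a = 5 then {({22, 44} : Multiset (ZMod 66))} + {({4, 33, 37, 58} : Multiset (ZMod 66))} + {({5, 27, 49, 51} : Multiset (ZMod 66))} + {({6, 30, 33, 63} : Multiset (ZMod 66))} else
  if a = 7 then {({4, 62} : Multiset (ZMod 66))} + {({24, 42} : Multiset (ZMod 66))} + {({7, 33, 40, 52} : Multiset (ZMod 66))} else
  if a = 9 then {({9, 57} : Multiset (ZMod 66))} + {({33, 33} : Multiset (ZMod 66))} else
  if a = 11 then {({11, 55} : Multiset (ZMod 66))} + {({33, 33} : Multiset (ZMod 66))} else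
  if a = 13 then {({4, 62} : Multiset (ZMod 66))} + {({6, 60} : Multiset (ZMod 66))} + {({13, 33, 40, 46} : Multiset (ZMod 66))} else
  if a = 14 then {({14, 52} : Multiset (ZMod 66))} + {({24, 42} : Multiset (ZMod 66))} else
  if a = 15 then {({15, 51} : Multiset (ZMod 66))} + {({33, 33} : Multiset (ZMod 66))} else
  if a = 16 then {({4, 62} : Multiset (ZMod 66))} + {({10, 56} : Multiset (ZMod 66))} + {({16, 50} : Multiset (ZMod 66))} + {({33, 33} : Multiset (ZMod 66))} + {({22, 34, 35, 41} : Multiset (ZMod 66))} else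
  if a = 17 then {({4, 62} : Multiset (ZMod 66))} + {({33, 33} : Multiset (ZMod 66))} + {({17, 22, 29, 64} : Multiset (ZMod 66))} else
  if a = 19 then {({33, 33} : Multiset (ZMod 66))} + {({2, 24, 46, 60} : Multiset (ZMod 66))} + {({12, 18, 40, 62} : Multiset (ZMod 66))} + {({13, 19, 44, 56} : Multiset (ZMod 66))} else
  if a = 20 then {({6, 20, 42, 64} : Multiset (ZMod 66))} else
  if a = 21 then {({21, 24, 33, 54} : Multiset (ZMod 66))} else
  if a = 23 then {({23, 43} : Multiset (ZMod 66))} + {({33, 33} : Multiset (ZMod 66))} + {({2, 24, 46, 60} : Multiset (ZMod 66))} else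
  if a = 25 then {({25, 41} : Multiset (ZMod 66))} + {({2, 33, 35, 62} : Multiset (ZMod 66))} + {({12, 30, 34, 56} : Multiset (ZMod 66))} else
  if a = 26 then {({4, 26, 48, 54} : Multiset (ZMod 66))} else
  if a = 27 then {({33, 33} : Multiset (ZMod 66))} + {({12, 27, 30, 63} : Multiset (ZMod 66))} else
  if a = 28 then {({4, 62} : Multiset (ZMod 66))} + {({10, 56} : Multiset (ZMod 66))} + {({33, 33} : Multiset (ZMod 66))} + {({6, 28, 48, 50} : Multiset (ZMod 66))} + {({22, 34, 35, 41} : Multiset (ZMod 66))} else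
  if a = 29 then {({8, 29, 33, 62} : Multiset (ZMod 66))} else
  if a = 31 then {({4, 31, 33, 64} : Multiset (ZMod 66))} else
  if a = 32 then {({10, 32, 36, 54} : Multiset (ZMod 66))} else
  if a = 34 then {({12, 30, 34, 56} : Multiset (ZMod 66))} else
  if a = 35 then {({2, 33, 35, 62} : Multiset (ZMod 66))} else
  if a = 36 then {({30, 36} : Multiset (ZMod 66))} else
  if a = 37 then {({4, 33, 37, 58} : Multiset (ZMod 66))} else
  if a = 38 then {({18, 48} : Multiset (ZMod 66))} + {({28, 38} : Multiset (ZMod 66))} + {({2, 33, 35, 62} : Multiset (ZMod 66))} + {({8, 33, 41, 50} : Multiset (ZMod 66))} + {({12, 30, 34, 56} : Multiset (ZMod 66))} else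
  if a = 39 then {({6, 33, 39, 54} : Multiset (ZMod 66))} else
  if a = 40 then {({12, 18, 40, 62} : Multiset (ZMod 66))} else
  if a = 41 then {({4, 62} : Multiset (ZMod 66))} + {({10, 56} : Multiset (ZMod 66))} + {({33, 33} : Multiset (ZMod 66))} + {({22, 34, 35, 41} : Multiset (ZMod 66))} else
  if a = 42 then {({24, 42} : Multiset (ZMod 66))} else
  if a = 43 then {({6, 60} : Multiset (ZMod 66))} + {({10, 33, 43, 46} : Multiset (ZMod 66))} else
  if a = 44 then {({22, 44} : Multiset (ZMod 66))} else
  if a = 45 then {({12, 33, 42, 45} : Multiset (ZMod 66))} else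
  if a = 46 then {({2, 24, 46, 60} : Multiset (ZMod 66))} else
  if a = 47 then {({4, 62} : Multiset (ZMod 66))} + {({6, 60} : Multiset (ZMod 66))} + {({10, 22, 47, 53} : Multiset (ZMod 66))} + {({13, 33, 40, 46} : Multiset (ZMod 66))} else
  if a = 48 then {({18, 48} : Multiset (ZMod 66))} else
  if a = 49 then {({8, 58} : Multiset (ZMod 66))} + {({33, 33} : Multiset (ZMod 66))} + {({2, 37, 44, 49} : Multiset (ZMod 66))} else
  if a = 50 then {({2, 33, 35, 62} : Multiset (ZMod 66))} + {({8, 33, 41, 50} : Multiset (ZMod 66))} + {({12, 30, 34, 56} : Multiset (ZMod 66))} else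
  if a = 51 then {({18, 30, 33, 51} : Multiset (ZMod 66))} else
  if a = 52 then {({8, 30, 42, 52} : Multiset (ZMod 66))} else
  if a = 53 then {({13, 53} : Multiset (ZMod 66))} + {({33, 33} : Multiset (ZMod 66))} + {({2, 24, 46, 60} : Multiset (ZMod 66))} + {({12, 18, 40, 62} : Multiset (ZMod 66))} else
  if a = 54 then {({12, 54} : Multiset (ZMod 66))} else
  if a = 55 then {({22, 22, 33, 55} : Multiset (ZMod 66))} else
  if a = 56 then {({10, 56} : Multiset (ZMod 66))} else
  if a = 57 then {({18, 24, 33, 57} : Multiset (ZMod 66))} else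
  if a = 58 then {({8, 58} : Multiset (ZMod 66))} else
  if a = 59 then {({7, 59} : Multiset (ZMod 66))} + {({33, 33} : Multiset (ZMod 66))} + {({8, 30, 42, 52} : Multiset (ZMod 66))} + {({12, 18, 40, 62} : Multiset (ZMod 66))} else
  if a = 60 then {({6, 60} : Multiset (ZMod 66))} else
  if a = 61 then {({2, 33, 35, 62} : Multiset (ZMod 66))} + {({12, 30, 34, 56} : Multiset (ZMod 66))} + {({18, 30, 33, 51} : Multiset (ZMod 66))} + {({8, 10, 15, 41, 61, 63} : Multiset (ZMod 66))} else
  if a = 62 then {({4, 62} : Multiset (ZMod 66))} else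
  if a = 63 then {({6, 30, 33, 63} : Multiset (ZMod 66))} else
  if a = 64 then {({2, 64} : Multiset (ZMod 66))} else
  if a = 65 then {({12, 54} : Multiset (ZMod 66))} + {({30, 36} : Multiset (ZMod 66))} + {({2, 32, 33, 65} : Multiset (ZMod 66))} else
  0

/-- `N66 a` — negative supply part of the level-66 reach certificate of `v_a`. [folklore] -/
def N66 (a : ZMod 66) : Multiset (Multiset (ZMod 66)) :=
  if a = 1 then {({2, 64} : Multiset (ZMod 66))} + {({12, 30, 34, 56} : Multiset (ZMod 66))} else
  if a = 3 then {({6, 30, 33, 63} : Multiset (ZMod 66))} else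
  if a = 5 then {({8, 58} : Multiset (ZMod 66))} + {({2, 37, 44, 49} : Multiset (ZMod 66))} + {({12, 27, 30, 63} : Multiset (ZMod 66))} + {({18, 30, 33, 51} : Multiset (ZMod 66))} else
  if a = 7 then {({8, 30, 42, 52} : Multiset (ZMod 66))} + {({12, 18, 40, 62} : Multiset (ZMod 66))} else
  if a = 9 then {({18, 24, 33, 57} : Multiset (ZMod 66))} else
  if a = 11 then {({22, 22, 33, 55} : Multiset (ZMod 66))} else
  if a = 13 then {({2, 24, 46, 60} : Multiset (ZMod 66))} + {({12, 18, 40, 62} : Multiset (ZMod 66))} else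
  if a = 14 then {({8, 30, 42, 52} : Multiset (ZMod 66))} else
  if a = 15 then {({18, 30, 33, 51} : Multiset (ZMod 66))} else
  if a = 16 then {({2, 33, 35, 62} : Multiset (ZMod 66))} + {({8, 33, 41, 50} : Multiset (ZMod 66))} + {({12, 30, 34, 56} : Multiset (ZMod 66))} else
  if a = 17 then {({2, 64} : Multiset (ZMod 66))} + {({8, 29, 33, 62} : Multiset (ZMod 66))} else
  if a = 19 then {({4, 62} : Multiset (ZMod 66))} + {({6, 60} : Multiset (ZMod 66))} + {({10, 56} : Multiset (ZMod 66))} + {({22, 44} : Multiset (ZMod 66))} + {({13, 33, 40, 46} : Multiset (ZMod 66))} else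
  if a = 20 then {({2, 64} : Multiset (ZMod 66))} + {({24, 42} : Multiset (ZMod 66))} else
  if a = 21 then {({12, 54} : Multiset (ZMod 66))} else
  if a = 23 then {({6, 60} : Multiset (ZMod 66))} + {({10, 33, 43, 46} : Multiset (ZMod 66))} else
  if a = 25 then {({4, 62} : Multiset (ZMod 66))} + {({10, 56} : Multiset (ZMod 66))} + {({22, 34, 35, 41} : Multiset (ZMod 66))} else
  if a = 26 then {({12, 54} : Multiset (ZMod 66))} + {({18, 48} : Multiset (ZMod 66))} else
  if a = 27 then {({6, 30, 33, 63} : Multiset (ZMod 66))} else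
  if a = 28 then {({18, 48} : Multiset (ZMod 66))} + {({2, 33, 35, 62} : Multiset (ZMod 66))} + {({8, 33, 41, 50} : Multiset (ZMod 66))} + {({12, 30, 34, 56} : Multiset (ZMod 66))} else
  if a = 29 then {({4, 62} : Multiset (ZMod 66))} else
  if a = 31 then {({2, 64} : Multiset (ZMod 66))} else
  if a = 32 then {({12, 54} : Multiset (ZMod 66))} + {({30, 36} : Multiset (ZMod 66))} else
  if a = 34 then {({10, 56} : Multiset (ZMod 66))} else
  if a = 35 then {({4, 62} : Multiset (ZMod 66))} else
  if a = 37 then {({8, 58} : Multiset (ZMod 66))} else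
  if a = 38 then {({4, 62} : Multiset (ZMod 66))} + {({10, 56} : Multiset (ZMod 66))} + {({33, 33} : Multiset (ZMod 66))} + {({6, 28, 48, 50} : Multiset (ZMod 66))} + {({22, 34, 35, 41} : Multiset (ZMod 66))} else
  if a = 39 then {({12, 54} : Multiset (ZMod 66))} else
  if a = 40 then {({4, 62} : Multiset (ZMod 66))} else
  if a = 41 then {({2, 33, 35, 62} : Multiset (ZMod 66))} + {({12, 30, 34, 56} : Multiset (ZMod 66))} else
  if a = 43 then {({2, 24, 46, 60} : Multiset (ZMod 66))} else
  if a = 45 then {({24, 42} : Multiset (ZMod 66))} else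
  if a = 46 then {({6, 60} : Multiset (ZMod 66))} else
  if a = 47 then {({13, 53} : Multiset (ZMod 66))} + {({2, 24, 46, 60} : Multiset (ZMod 66))} + {({12, 18, 40, 62} : Multiset (ZMod 66))} else
  if a = 49 then {({22, 44} : Multiset (ZMod 66))} + {({4, 33, 37, 58} : Multiset (ZMod 66))} else
  if a = 50 then {({4, 62} : Multiset (ZMod 66))} + {({10, 56} : Multiset (ZMod 66))} + {({33, 33} : Multiset (ZMod 66))} + {({22, 34, 35, 41} : Multiset (ZMod 66))} else
  if a = 52 then {({24, 42} : Multiset (ZMod 66))} else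
  if a = 53 then {({4, 62} : Multiset (ZMod 66))} + {({6, 60} : Multiset (ZMod 66))} + {({13, 33, 40, 46} : Multiset (ZMod 66))} else
  if a = 59 then {({4, 62} : Multiset (ZMod 66))} + {({24, 42} : Multiset (ZMod 66))} + {({7, 33, 40, 52} : Multiset (ZMod 66))} else
  if a = 61 then {({4, 62} : Multiset (ZMod 66))} + {({10, 56} : Multiset (ZMod 66))} + {({15, 51} : Multiset (ZMod 66))} + {({6, 30, 33, 63} : Multiset (ZMod 66))} + {({22, 34, 35, 41} : Multiset (ZMod 66))} else
  if a = 65 then {({10, 32, 36, 54} : Multiset (ZMod 66))} else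
  0

/-- `CertShape66[u]`: a pair, a LISTED Hodge 4-multiset, a listed semi-decomposable sextuple, or a listed standard element. -/
local notation3 (prettyPrint := false) "CertShape66[" u "]" =>
  ((∃ a : ZMod 66, a ≠ 0 ∧ u = ({a, -a} : Multiset (ZMod 66))) ∨ u ∈ H4List66 ∨
    u ∈ (SemiList66).map (fun tu ↦ tu.1 + tu.2) ∨ u ∈ StdList66)

/-- Every certificate shape is a supply element of level `66`. [folklore] -/
theorem mem_supply_of_certShape66 {u : Multiset (ZMod 66)} (h : CertShape66[u]) : u ∈ Supply[66] := by
  rcases h with h | h | h | h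
  · exact Or.inl (Or.inl (Or.inl h))
  · exact Or.inl (Or.inl (Or.inr (h4List66_hodge h)))
  · exact semiList66_mem_supply h
  · exact stdList66_mem_supply u h

set_option maxRecDepth 100000 in set_option maxHeartbeats 8000000 in
/-- **The 54 basis certificates** (level `66`, `a ≠ 33`): `A a + E a + Σ(N a) = B a + Σ(P a)`. [folklore] -/
theorem cert66_of_mem_F : ∀ a ∈ Fset.erase 33, A a + E a + (N66 a).sum = B a + (P66 a).sum := by
  unfold Fset A B E EpsF N66 P66; decide +kernel

set_option maxRecDepth 100000 in set_option maxHeartbeats 8000000 in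
/-- All generators used have a certificate shape. [folklore] -/
theorem certShape_of_mem_F66 : ∀ a ∈ Fset.erase 33, ∀ u ∈ P66 a + N66 a, CertShape66[u] := by
  unfold Fset P66 N66 H4List66 SemiList66 StdList66; decide +kernel

set_option maxRecDepth 100000 in set_option maxHeartbeats 4000000 in
/-- `33` is free and `v_33 = e_33`: `A 33 = {33}`, `B 33 = 0`. [folklore] -/
theorem a0_facts : (33 : ZMod 66) ∈ Fset ∧ A 33 = {33} ∧ B 33 = 0 := by
  unfold Fset A B; decide +kernel

set_option maxRecDepth 100000 in set_option maxHeartbeats 4000000 in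
/-- `EpsF ⊆ F ∖ {33}`: filtering `F ∖ {33}` by membership in `EpsF` gives `EpsF`; `33 ∉ EpsF`; and the odd-parity
subset of `F` is `insert 33 EpsF`. [folklore] -/
theorem filter_epsF : (Fset.erase 33).filter (· ∈ EpsF) = EpsF ∧ (33 : ZMod 66) ∉ EpsF ∧
    Fset.filter (fun a ↦ a = 33 ∨ a ∈ EpsF) = insert (33 : ZMod 66) EpsF := by
  unfold Fset EpsF; decide +kernel

set_option maxRecDepth 100000 in set_option maxHeartbeats 4000000 in
/-- **Parity table**: `|A a| + |B a|` is odd exactly for `a = 33` and `a ∈ EpsF`. [folklore] -/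
theorem card_parity : ∀ a ∈ Fset, ((Multiset.card (A a) + Multiset.card (B a) : ℕ) : ZMod 2) =
    if a = 33 ∨ a ∈ EpsF then 1 else 0 := by
  unfold Fset EpsF A B; decide +kernel

/-- **The `33`-coordinate parity**: for a Hodge multiset `s` (even cardinality, `IsHodgeMultiset.even_card`),
`c_33(s) + Σ_{a ∈ EpsF} c_a(s)` is even — the shadow of `[L_66 : K_66] = 2`. [folklore] -/
theorem even_count_a0 {s : Multiset (ZMod 66)} (hs : IsHodgeMultiset s) :
    Even (Multiset.count 33 s + ∑ a ∈ EpsF, Multiset.count a s) := by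
  have hI := graph_identity66 hs
  have hcard := congrArg Multiset.card hI
  simp only [Multiset.card_add, Multiset.card_sum, Multiset.card_nsmul] at hcard
  have h2 : ((Multiset.card s : ℕ) : ZMod 2) = 0 := ZMod.natCast_eq_zero_iff_even.2 hs.even_card
  have hc2 := congrArg (fun n : ℕ ↦ (n : ZMod 2)) hcard
  simp only [Nat.cast_add, Nat.cast_sum, Nat.cast_mul, h2, zero_add] at hc2
  have hsum : ∑ a ∈ Fset, (Multiset.count a s : ZMod 2) * ((Multiset.card (A a) + Multiset.card (B a) : ℕ) : ZMod 2) = 0 := by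
    have hxx : ∀ x : ZMod 2, x + x = 0 := by decide
    simp only [Nat.cast_add, mul_add, Finset.sum_add_distrib, hc2, hxx]
  rw [Finset.sum_congr rfl fun a ha ↦ by rw [card_parity a ha]] at hsum
  simp only [mul_ite, mul_one, mul_zero] at hsum
  rw [← Finset.sum_filter, filter_epsF.2.2, Finset.sum_insert filter_epsF.2.1] at hsum
  apply ZMod.natCast_eq_zero_iff_even.1
  push_cast
  exact hsum

/-- The pair `{33, 33} = {33, −33}` is a supply element. [folklore] -/
theorem pair_a0_mem_supply : ({33, 33} : Multiset (ZMod 66)) ∈ Supply[66] :=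
  Or.inl (Or.inl (Or.inl ⟨33, by decide, by decide⟩))

set_option maxRecDepth 100000 in set_option maxHeartbeats 4000000 in
/-- **D66 — every Hodge multiset of `ℤ/66` is ℤ-reachable from the printed supply of level `66`** (the
`33`-coordinate is balanced by copies of the pair `{33, 33}` on both sides). [folklore] -/
theorem reach_sixtySix (s : Multiset (ZMod 66)) (hs : IsHodgeMultiset s) : Reach[66, s] := by
  obtain ⟨c, hc⟩ : ∃ c : ZMod 66 → ℕ, c = fun a ↦ Multiset.count a s := ⟨_, rfl⟩
  have hI : s + ∑ a ∈ Fset, c a • B a = ∑ a ∈ Fset, c a • A a := by rw [hc]; exact graph_identity66 hs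
  rw [← Finset.insert_erase a0_facts.1, Finset.sum_insert (Finset.notMem_erase _ _),
    Finset.sum_insert (Finset.notMem_erase _ _), a0_facts.2.1, a0_facts.2.2, smul_zero, zero_add] at hI
  obtain ⟨T, hT⟩ : ∃ T : ℕ, T = ∑ a ∈ EpsF, c a := ⟨_, rfl⟩
  have hpar : Even (c 33 + T) := by rw [hT, hc]; exact even_count_a0 hs
  obtain ⟨r, hr⟩ := hpar
  refine ⟨(∑ a ∈ Fset.erase 33, c a • P66 a) + r • {({33, 33} : Multiset (ZMod 66))},
    (∑ a ∈ Fset.erase 33, c a • N66 a) + T • {({33, 33} : Multiset (ZMod 66))}, ?_, ?_, ?_⟩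
  · intro u hu
    rcases Multiset.mem_add.1 hu with hu | hu
    · obtain ⟨a, ha, hu⟩ := Multiset.mem_sum.1 hu
      exact mem_supply_of_certShape66 (certShape_of_mem_F66 a ha u (Multiset.mem_add.2 (Or.inl (Multiset.mem_of_mem_nsmul hu))))
    · rw [Multiset.mem_singleton.1 (Multiset.mem_of_mem_nsmul hu)]; exact pair_a0_mem_supply
  · intro u hu
    rcases Multiset.mem_add.1 hu with hu | hu
    · obtain ⟨a, ha, hu⟩ := Multiset.mem_sum.1 hu
      exact mem_supply_of_certShape66 (certShape_of_mem_F66 a ha u (Multiset.mem_add.2 (Or.inr (Multiset.mem_of_mem_nsmul hu))))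
    · rw [Multiset.mem_singleton.1 (Multiset.mem_of_mem_nsmul hu)]; exact pair_a0_mem_supply
  · have hII : ∑ a ∈ Fset.erase 33, c a • (A a + E a + (N66 a).sum) = ∑ a ∈ Fset.erase 33, c a • (B a + (P66 a).sum) :=
      Finset.sum_congr rfl fun a ha ↦ by rw [cert66_of_mem_F a ha]
    simp only [nsmul_add, Finset.sum_add_distrib] at hII
    have hE : ∑ a ∈ Fset.erase 33, c a • E a = T • ({33} : Multiset (ZMod 66)) := by
      simp only [E, smul_ite, smul_zero]
      rw [← Finset.sum_filter, filter_epsF.1, Finset.sum_nsmul_assoc, ← hT]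
    rw [hE] at hII
    rw [Multiset.sum_add, Multiset.sum_add, sum_nsmul', sum_nsmul', Multiset.sum_singleton, sum_sum_nsmul,
      sum_sum_nsmul]
    have hD : ({33, 33} : Multiset (ZMod 66)) = {33} + {33} := by decide
    have hr' : c 33 + T + T = r + r + T := by omega
    rw [hD, nsmul_add, nsmul_add]
    have key : s + ((∑ a ∈ Fset.erase 33, c a • (N66 a).sum) + (T • ({33} : Multiset (ZMod 66)) + T • ({33} : Multiset (ZMod 66)))) + ((∑ a ∈ Fset.erase 33, c a • B a) + (∑ a ∈ Fset.erase 33, c a • A a) + T • ({33} : Multiset (ZMod 66))) =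
        ((∑ a ∈ Fset.erase 33, c a • (P66 a).sum) + (r • ({33} : Multiset (ZMod 66)) + r • ({33} : Multiset (ZMod 66)))) + ((∑ a ∈ Fset.erase 33, c a • B a) + (∑ a ∈ Fset.erase 33, c a • A a) + T • ({33} : Multiset (ZMod 66))) := by
      calc s + ((∑ a ∈ Fset.erase 33, c a • (N66 a).sum) + (T • ({33} : Multiset (ZMod 66)) + T • ({33} : Multiset (ZMod 66)))) + ((∑ a ∈ Fset.erase 33, c a • B a) + (∑ a ∈ Fset.erase 33, c a • A a) + T • ({33} : Multiset (ZMod 66)))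
          = (s + ∑ a ∈ Fset.erase 33, c a • B a) + ((∑ a ∈ Fset.erase 33, c a • A a) + T • ({33} : Multiset (ZMod 66)) + ∑ a ∈ Fset.erase 33, c a • (N66 a).sum) + (T • ({33} : Multiset (ZMod 66)) + T • ({33} : Multiset (ZMod 66))) := by abel
        _ = (c 33 • ({33} : Multiset (ZMod 66)) + ∑ a ∈ Fset.erase 33, c a • A a) + ((∑ a ∈ Fset.erase 33, c a • B a) + ∑ a ∈ Fset.erase 33, c a • (P66 a).sum) + (T • ({33} : Multiset (ZMod 66)) + T • ({33} : Multiset (ZMod 66))) := by rw [hI, hII]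
        _ = (∑ a ∈ Fset.erase 33, c a • (P66 a).sum) + (c 33 + T + T) • ({33} : Multiset (ZMod 66)) + ((∑ a ∈ Fset.erase 33, c a • B a) + (∑ a ∈ Fset.erase 33, c a • A a)) := by rw [add_nsmul, add_nsmul]; abel
        _ = (∑ a ∈ Fset.erase 33, c a • (P66 a).sum) + (r + r + T) • ({33} : Multiset (ZMod 66)) + ((∑ a ∈ Fset.erase 33, c a • B a) + (∑ a ∈ Fset.erase 33, c a • A a)) := by rw [hr']
        _ = ((∑ a ∈ Fset.erase 33, c a • (P66 a).sum) + (r • ({33} : Multiset (ZMod 66)) + r • ({33} : Multiset (ZMod 66)))) + ((∑ a ∈ Fset.erase 33, c a • B a) + (∑ a ∈ Fset.erase 33, c a • A a) + T • ({33} : Multiset (ZMod 66))) := by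
            rw [add_nsmul, add_nsmul]; abel
    exact add_right_cancel key

/-- Level raising by `k = 1` is the identity. [folklore] -/
theorem levelRaise_one (s : Multiset (ZMod 66)) : LevelRaise[1, 66, s] = s := by
  conv_rhs => rw [← Multiset.map_id s]
  refine Multiset.map_congr rfl fun a _ ↦ ?_
  simp only [one_mul, id_eq]
  exact ZMod.natCast_zmod_val a

/-- **Stable reachability in degree `66`** (`k = 1`). [folklore] -/
theorem stableReach_sixtySix : ∀ s : Multiset (ZMod 66), IsHodgeMultiset s → StableReach[66, s] :=
  fun s hs ↦ ⟨1, Nat.one_pos, by rw [levelRaise_one]; exact reach_sixtySix s hs⟩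

/-! ### Pay-off: HC for every Fermat variety of degree 66, modulo the named facts and the remaining stubs -/

open CategoryTheory AlgebraicGeometry
open Literature.AlgebraicGeometry Literature.AlgebraicGeometry.Motives Literature.AlgebraicTopology.SingularHomology

/-- **Claim for every non-empty Hodge multiset of level `66`**, granted the named facts and the statements of
S2↑, S2↓, S3a (landed S1, S3b; proved S2 (a)). [folklore assembly] -/
theorem claimMultiset_sixtySix
    (hJ : Aoki1987_claim_juxtaposition) (hC : Aoki1987_claim_of_claim_juxtaposition_paired)
    (hP : Shioda_claim_paired) (hNS : AokiShioda1983_eigenline_le_neronSeveri) (hS : Aoki1987_claim_pStandard)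
    (hPull : ∀ (m k r : ℕ) (α' : Fin (2 * r + 2) → ZMod m), 0 < k → (∀ i, α' i ≠ 0) →
      FermatCharacter.Claim m r α' → FermatCharacter.Claim (k * m) r (fun i => ((k * (α' i).val : ℕ) : ZMod (k * m))))
    (hPush : ∀ (m k r : ℕ) (α' : Fin (2 * r + 2) → ZMod m), 0 < k → (∀ i, α' i ≠ 0) →
      FermatCharacter.Claim (k * m) r (fun i => ((k * (α' i).val : ℕ) : ZMod (k * m))) → FermatCharacter.Claim m r α')
    (h3a : ∀ (M : ℕ) [NeZero M] (s : Multiset (ZMod M)), IsHodgeMultiset s → IsSemiDecomposable s → ClaimMultiset M s)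
    {s : Multiset (ZMod 66)} (hs0 : s ≠ 0) (hs : IsHodgeMultiset s) : ClaimMultiset 66 s := by
  have h2 : ∀ (m k : ℕ) [NeZero m], 0 < k → ∀ s : Multiset (ZMod m), s ≠ 0 → IsHodgeMultiset s →
      IsHodgeMultiset (LevelRaise[k, m, s]) ∧ (ClaimMultiset m s ↔ ClaimMultiset (k * m) (LevelRaise[k, m, s])) :=
    fun m k _ hk s hs0 hs ↦ ⟨isHodgeMultiset_levelRaise m k hk s hs0 hs,
      claimMultiset_levelRaise_iff_of_pull_push hPull hPush m k hk s hs0 hs⟩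
  obtain ⟨P, N, hPs, hNs, hEq⟩ := reach_sixtySix s hs
  exact stub_latticeCriterion hJ hC 66 (Supply[66]) (stub_printedSupply hP hNS hS h3a h2 66) s P N hs0 hs hPs hNs hEq

/-- **HC FOR EVERY COMPLEX FERMAT VARIETY OF DEGREE `66`**, granted the six named facts of S0 and the statements of
the stubs S2↑, S2↓, S3a and S5 (Ran 1980 Prop. 1.7 at `m = 66`); no engine and no level change: degree `66` is
saturated at its own level. [cite: Shioda1979PJA, §2 Thm. 1] [cite: Aoki1987, Thm 1-4, Thm 2-1] -/
theorem hodgeConjectureFor_sixtySix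
    (hJ : Aoki1987_claim_juxtaposition) (hC : Aoki1987_claim_of_claim_juxtaposition_paired)
    (hP : Shioda_claim_paired) (hNS : AokiShioda1983_eigenline_le_neronSeveri) (hS : Aoki1987_claim_pStandard)
    (hModel : ∀ (n : ℕ) (X : SchemeOver ℂ), nonempty_hodgeModel n X)
    (hPull : ∀ (m k r : ℕ) (α' : Fin (2 * r + 2) → ZMod m), 0 < k → (∀ i, α' i ≠ 0) →
      FermatCharacter.Claim m r α' → FermatCharacter.Claim (k * m) r (fun i => ((k * (α' i).val : ℕ) : ZMod (k * m))))
    (hPush : ∀ (m k r : ℕ) (α' : Fin (2 * r + 2) → ZMod m), 0 < k → (∀ i, α' i ≠ 0) →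
      FermatCharacter.Claim (k * m) r (fun i => ((k * (α' i).val : ℕ) : ZMod (k * m))) → FermatCharacter.Claim m r α')
    (h3a : ∀ (M : ℕ) [NeZero M] (s : Multiset (ZMod M)), IsHodgeMultiset s → IsSemiDecomposable s → ClaimMultiset M s)
    (h5 : ∀ ⦃p : ℕ⦄, 0 < p →
      (∀ α : Fin (2 * p + 2) → ZMod 66, α ≠ 0 → (∃ i, α i = 0) → fermatEigenspace 66 α (2 * p) = ⊥) ∧
      (fermatEigenspace 66 (0 : Fin (2 * p + 2) → ZMod 66) (2 * p) ≤
        LinearMap.range (complexBetti.map (SmoothHypersurface.hypersurfaceι (fermatPolynomial ℂ (2 * p) 66)) (2 * p)).hom) ∧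
      (∀ (A : HodgeModel (2 * p) (fermatHypersurface (2 * p) 66)) (β : Fin (2 * p + 2) → ZMod 66),
        (∀ i, β i ≠ 0) →
        (∃ x ∈ fermatEigenspace 66 β (2 * p), x ≠ 0 ∧ A.pullback (2 * p) x ∈ A.hodgePQ (2 * p) p p) →
          2 * FermatCharacter.normSum β = 66 * (2 * p + 2)))
    ⦃n : ℕ⦄ ⦃X : SchemeOver ℂ⦄ (hF : IsFermatVariety n 66 X) (hX : IsSmoothProjective n X) :
    HodgeConjectureFor n X := by
  refine ⟨hModel n X hX, fun p c hc hpp ↦ ?_⟩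
  refine hodgeClasses_algebraic_fermat_of_claims_at' (m := 66) h5 (fun p hp α hα ↦ ?_) hF hX p c hc hpp
  have hs : IsHodgeMultiset (univ.val.map α) := hα.isHodgeMultiset
  have hs0 : univ.val.map α ≠ 0 := by
    intro h0
    have hcard := congrArg Multiset.card h0
    rw [card_univ_val_map, Multiset.card_zero] at hcard
    omega
  exact (claimMultiset_univ_val_map_iff α).1 (claimMultiset_sixtySix hJ hC hP hNS hS hPull hPush h3a hs0 hs)

end Summit.HodgeConjecture.HodgeConjecture.Theorems.CancelByAnyClaimLattice.D66

end
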